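import Literature.Combinatorics.Optimization.TracialDesigns
import Literature.Barriers.PneNP.TSPExtensionComplexityKaibelWeltge
import HarnessLib

/-!
# Barrier: no generic lifting of one-sided rectangle decay from dimension 1 to dimension `r` with sub-exponential loss
# (the unique-disjointness matrix: Fiorini–Massar–Pokutta–Tiwary–de Wolf 2015, §5.3, with Kaibel–Weltge's count)

Cell pnp-psdrank, route `ChebyshevTracialDesign`. The crux `TracialDecayExp20` asks for a bound `e^{−a·dq n}` on the
normalised-trace value `(1/r) Σ_{U,M} W(U,M) tr(X_U Y_M)` of a weight `W` on psd contractions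
`0 ⪯ X_U, Y_M ⪯ I_r` that are TIGHT (`X_U Y_M = 0` on a prescribed zero pattern, the tight pairs), in every
dimension `r ≤ e^{a·dq n/2}/√n`; its `r = 1` shadow — `W(A × B) ≤ γ₁` for every 0/1 rectangle AVOIDING the
tight pairs — is the rung the cell has assembled (modulo one published inequality). A tempting closing move is
a GENERIC transfer principle: «for every weight `W ≥ 0` and every zero pattern `T`, if all `T`-free rectangles
have `W`-mass `≤ γ` then every `T`-tight psd strategy of dimension `r` has value `≤ F(r)·γ`» — with a loss `F`
polynomial in `r` this would prove the crux from the `r = 1` rung (`r^C = e^{C a dq n}` is absorbed by the choice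
of `a`). This file PROVES (no named fact) that no such principle exists with `F(r) < (3/2)^{r−1}/r³`:

the witness is the UNIQUE-DISJOINTNESS matrix of Fiorini–Massar–Pokutta–Tiwary–de Wolf, `M_{ab} = (1 − aᵀb)²`
(`a, b ⊆ [n]`), with its explicit rank-`(n+1)` psd factorisation `T_a = (1,−a)(1,−a)ᵀ`, `U^b = (1,b)(1,b)ᵀ`,
`Tr[T_a U^b] = (1 − aᵀb)²` [cite: FioriniEtAl2015, §5.3, Thm. 21 and Cor. 22 (proof: "a simple rank-(n+1) PSD factorization of M")]
and Kaibel–Weltge's count: a set of DISJOINT pairs on which `|a ∩ b'| ≠ 1` throughout has at most `2^n` members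
[cite: KaibelWeltge2014, Thm. 1] (the tree's `IsKWValid.card_le_two_pow`; with `|disjpairs(n)| = 3^n`,
`card_disjPairs`). Reading: take the weight `W` = uniform probability on the `3^n` disjoint pairs and the tight
pattern `T(a,b) :⟺ |a ∩ b| = 1`. Then

* (`udisj_rectMass_le`) every `T`-free 0/1 rectangle has `W(A × B) ≤ (2/3)^n` — ONE-SIDED RECTANGLE DECAY,
  exponential in `n`;
* (`isTightPsdRect_udisj`, `tracialValue_udisj`) the pure states `X_a = (1,−1_a)(1,−1_a)ᵀ/(n+1)`,
  `Y_b = (1,1_b)(1,1_b)ᵀ/(n+1)` are psd contractions of dimension `r = n + 1` with `X_a Y_b = 0` whenever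
  `|a ∩ b| = 1`, and their value is `(1/r) Σ W tr(X_a Y_b) = 1/(n+1)³` — only POLYNOMIALLY small;
* (`GenericOneSidedTransfer`, the TECHNIQUE CLASS) hence every generic transfer principle has loss
  `F(n+1) ≥ (3/2)^n/(n+1)³` (`genericOneSidedTransfer_loss`), and NO polynomial loss is possible
  (`not_genericOneSidedTransfer_poly`).

technique_class: generic one-sided lifting — arguments deducing the dimension-`r` tight tracial bound from the
  `r = 1` tight-free rectangle bound ALONE, uniformly over weights `W ≥ 0` and zero patterns `T`, with a loss
  factor `F(r)` (`GenericOneSidedTransfer F`); e.g. «a tight psd kernel `tr(X_a Y_b)/r` is a combination of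
  `T`-free rectangles of total weight `≤ F(r)`» (true with `F ≡ 1` for commutative / rank-one strategies by layer
  cake). [cite: FioriniEtAl2015, §5.3, Thm. 21]
blocks: closing the crux `TracialDecayExp20` of `Literature.Combinatorics.Optimization.TracialDesigns` from its
  `r = 1` rung by any such principle with `F(r) = r^{O(1)}` (which would suffice there): the loss is at least
  `(3/2)^{r−1}/r³` (`genericOneSidedTransfer_loss`, `not_genericOneSidedTransfer_poly`). A proof of the crux for
  `r > 1` must therefore use the structure of cuts × matchings / of the designs beyond the rectangle bound.
  [cite: FioriniEtAl2015, §5.3, Thm. 21 and Cor. 22]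
because: for UDISJ the `T`-free rectangles carry `≤ 2^n` of the `3^n` disjoint pairs (Kaibel–Weltge
  [cite: KaibelWeltge2014, Thm. 1]; Razborov / de Wolf in the original [cite: FioriniEtAl2015, §2, Thm. 1]),
  while the rank-`(n+1)` pure-state factorisation of `(1 − aᵀb)²` is tight on `|a ∩ b| = 1` and has value
  `1/(n+1)³` against the uniform weight on disjoint pairs — the psd-vs-nonnegative-rank separation of
  [cite: FioriniEtAl2015, §5.3, Cor. 22] read at the level of normalised tracial values.
evasions_known: structure-specific arguments — for the matching slack the cell's landed bricks (commutative,
  block-diagonal, finitely-valued, dictionary strategies) obtain `F = O(1)` or `F = L` from the SHAPE of the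
  strategy, not from a generic principle; symmetry (`S_n`-invariance of the designs) and exactness are further
  structure UDISJ does not have. None is known to reach general dimension `r`. [cite: FioriniEtAl2015, §5.3]
scope_caveats: the barrier refutes only transfer principles UNIFORM in `(W, T)`; it says nothing about the crux
  itself (whose weight is a signed exact design on cuts × matchings, not a probability on disjoint pairs), and the
  UDISJ pattern is not claimed to embed into the matching slack matrix. Constants: the printed separation is
  `rk_psd = O(n)` vs `rk_+ = 2^{Ω(n)}`; the explicit `(2/3)^n` (Kaibel–Weltge) and `1/(n+1)³` (normalisation of the
  pure states to contractions) are ours and proved below. [cite: KaibelWeltge2014, Thm. 1]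
status: established (J. ACM 2015; the count and the factorisation are proved in the tree / below).
-/

noncomputable section

open Finset Matrix Filter

namespace Literature.Barriers.PneNP

/-! ### §1 Generic tight psd rectangles, tracial value, and the technique class -/

section Generic

variable {α β : Type*} [Fintype α] [Fintype β]

/-- A **`T`-tight psd rectangle of dimension `r`** on `α × β`: contractions `0 ⪯ X_a, Y_b ⪯ I_r` with
`X_a Y_b = 0` whenever `T a b` (for cuts × matchings and `T = (cc = 1)` this is
`Literature.Combinatorics.Optimization.IsPsdRect`). [cite: FioriniEtAl2015, §5.3 (PSD factorizations), Thm. 21] -/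
def IsTightPsdRect (T : α → β → Prop) {r : ℕ} (X : α → Matrix (Fin r) (Fin r) ℝ)
    (Y : β → Matrix (Fin r) (Fin r) ℝ) : Prop :=
  (∀ a, (X a).PosSemidef ∧ (1 - X a).PosSemidef) ∧ (∀ b, (Y b).PosSemidef ∧ (1 - Y b).PosSemidef) ∧
    ∀ a b, T a b → X a * Y b = 0

/-- The normalised tracial value `(1/r) Σ_{a,b} W(a,b) tr(X_a Y_b)`. [cite: FioriniEtAl2015, §5.3, Thm. 21] -/
def tracialValue (W : α → β → ℝ) {r : ℕ} (X : α → Matrix (Fin r) (Fin r) ℝ)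
    (Y : β → Matrix (Fin r) (Fin r) ℝ) : ℝ :=
  (∑ a, ∑ b, W a b * (X a * Y b).trace) / r

/-- The `W`-mass of the 0/1 rectangle `A × B`. [cite: FioriniEtAl2015, §2 (rectangles)] -/
def rectMass (W : α → β → ℝ) (A : Finset α) (B : Finset β) : ℝ := ∑ a ∈ A, ∑ b ∈ B, W a b

end Generic

/-- **The technique class: generic one-sided transfer with loss `F`.** For ALL finite index types, all zero
patterns `T`, all weights `W ≥ 0`, all `γ` and all dimensions `r`: if every `T`-free 0/1 rectangle has `W`-mass
`≤ γ`, then every `T`-tight psd rectangle of dimension `r` has tracial value `≤ F(r)·γ`. (True with `F ≡ 1` in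
dimension `1` and for commutative strategies, by layer-cake decomposition into `T`-free rectangles.)
[cite: FioriniEtAl2015, §5.3, Thm. 21 and Cor. 22] -/
def GenericOneSidedTransfer (F : ℕ → ℝ) : Prop :=
  ∀ (α β : Type) [Fintype α] [Fintype β] (T : α → β → Prop) (W : α → β → ℝ) (γ : ℝ) (r : ℕ),
    (∀ a b, 0 ≤ W a b) →
    (∀ (A : Finset α) (B : Finset β), (∀ a ∈ A, ∀ b ∈ B, ¬T a b) → rectMass W A B ≤ γ) →
    ∀ (X : α → Matrix (Fin r) (Fin r) ℝ) (Y : β → Matrix (Fin r) (Fin r) ℝ),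
      IsTightPsdRect T X Y → tracialValue W X Y ≤ F r * γ

/-- The SIGN-UNRESTRICTED form of the principle (the form the crux would need: its weight `levelWeight` is a
signed exact design): no hypothesis `W ≥ 0`. It implies the restricted form, so it is refuted a fortiori
(`not_genericOneSidedTransferSigned_poly`). [cite: FioriniEtAl2015, §5.3, Thm. 21 and Cor. 22] -/
def GenericOneSidedTransferSigned (F : ℕ → ℝ) : Prop :=
  ∀ (α β : Type) [Fintype α] [Fintype β] (T : α → β → Prop) (W : α → β → ℝ) (γ : ℝ) (r : ℕ),
    (∀ (A : Finset α) (B : Finset β), (∀ a ∈ A, ∀ b ∈ B, ¬T a b) → rectMass W A B ≤ γ) →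
    ∀ (X : α → Matrix (Fin r) (Fin r) ℝ) (Y : β → Matrix (Fin r) (Fin r) ℝ),
      IsTightPsdRect T X Y → tracialValue W X Y ≤ F r * γ

/-- The sign-unrestricted principle implies the restricted one. [cite: FioriniEtAl2015, §5.3, Thm. 21] -/
theorem GenericOneSidedTransferSigned.restrict {F : ℕ → ℝ} (h : GenericOneSidedTransferSigned F) :
    GenericOneSidedTransfer F :=
  fun α β _ _ T W γ r _ hrect X Y hXY => h α β T W γ r hrect X Y hXY

/-- **The crux's setting is an instance of the class's data.** On cuts × matchings with the tight pattern
`|δ(U) ∩ M| = 1`, `IsTightPsdRect` is the route's `IsPsdRect` … [cite: Rothvoss2017, §2 (PDF p. 6)] -/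
theorem isTightPsdRect_iff_isPsdRect {n r : ℕ} (X : OddSet n → Matrix (Fin r) (Fin r) ℝ)
    (Y : PMatch n → Matrix (Fin r) (Fin r) ℝ) :
    IsTightPsdRect (fun U M => cc U M = 1) X Y ↔ Literature.Combinatorics.Optimization.IsPsdRect X Y :=
  Iff.rfl

/-- … and `TracialValueLEAt W γ r` says exactly that every such rectangle has `tracialValue W X Y ≤ γ`; the crux's
`r = 1` rung bounds `rectMass (levelWeight n t C w)` on tight-free rectangles. So a valid
`GenericOneSidedTransferSigned F` with `F(r) = r^{O(1)}` WOULD close the crux from its `r = 1` rung — and no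
such principle exists (below). [cite: GriblingDelaatLaurent2019, §5] [cite: Rothvoss2017, §2 (PDF pp. 6–7)] -/
theorem tracialValueLEAt_iff {n r : ℕ} (W : OddSet n → PMatch n → ℝ) (γ : ℝ) :
    Literature.Combinatorics.Optimization.TracialValueLEAt W γ r ↔
      ∀ (X : OddSet n → Matrix (Fin r) (Fin r) ℝ) (Y : PMatch n → Matrix (Fin r) (Fin r) ℝ),
        IsTightPsdRect (fun U M => cc U M = 1) X Y → tracialValue W X Y ≤ γ :=
  Iff.rfl

/-! ### §2 Scaled pure states are tight contractions (generic index type) -/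

section RankOne

variable {d : Type*} [Fintype d] [DecidableEq d]

omit [DecidableEq d] in
/-- `(c·uuᵀ)(c'·vvᵀ) = (c c' ⟨u,v⟩)·uvᵀ`. [folklore] -/
private theorem smul_vecMulVec_mul_smul_vecMulVec (c c' : ℝ) (u v : d → ℝ) :
    (c • vecMulVec u u) * (c' • vecMulVec v v) = (c * c' * (u ⬝ᵥ v)) • vecMulVec u v := by
  rw [Matrix.smul_mul, Matrix.mul_smul, vecMulVec_mul_vecMulVec, vecMulVec_smul, smul_smul, smul_smul]

omit [DecidableEq d] in
/-- `tr((c·uuᵀ)(c'·vvᵀ)) = c c' ⟨u,v⟩²`. [folklore] -/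
private theorem trace_smul_vecMulVec_mul_smul_vecMulVec (c c' : ℝ) (u v : d → ℝ) :
    ((c • vecMulVec u u) * (c' • vecMulVec v v)).trace = c * c' * (u ⬝ᵥ v) ^ 2 := by
  rw [smul_vecMulVec_mul_smul_vecMulVec, trace_smul, trace_vecMulVec, smul_eq_mul, sq, mul_assoc]

omit [DecidableEq d] in
/-- A real symmetric idempotent matrix is positive semidefinite. [folklore] -/
private theorem posSemidef_of_transpose_of_idem {A : Matrix d d ℝ} (hs : Aᵀ = A) (hi : A * A = A) :
    A.PosSemidef := by
  have h := posSemidef_conjTranspose_mul_self A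
  rwa [conjTranspose_eq_transpose_of_trivial, hs, hi] at h

/-- … and so is `1 − A`. [folklore] -/
private theorem posSemidef_one_sub_of_transpose_of_idem {A : Matrix d d ℝ} (hs : Aᵀ = A) (hi : A * A = A) :
    (1 - A).PosSemidef := by
  refine posSemidef_of_transpose_of_idem (by rw [transpose_sub, transpose_one, hs]) ?_
  rw [Matrix.sub_mul, Matrix.one_mul, Matrix.mul_sub, Matrix.mul_one, hi, sub_self, sub_zero]

omit [DecidableEq d] in
/-- The normalised rank-one matrix `(u·u)⁻¹·uuᵀ` (`u ≠ 0`) is idempotent. [folklore] -/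
private theorem rankOneProj_idem {u : d → ℝ} (hu : u ⬝ᵥ u ≠ 0) :
    ((u ⬝ᵥ u)⁻¹ • vecMulVec u u) * ((u ⬝ᵥ u)⁻¹ • vecMulVec u u) = (u ⬝ᵥ u)⁻¹ • vecMulVec u u := by
  rw [smul_vecMulVec_mul_smul_vecMulVec, mul_assoc, inv_mul_cancel₀ hu, mul_one]

omit [Fintype d] [DecidableEq d] in
/-- `c·uuᵀ` is symmetric. [folklore] -/
private theorem rankOneProj_transpose (c : ℝ) (u : d → ℝ) : (c • vecMulVec u u)ᵀ = c • vecMulVec u u := by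
  rw [transpose_smul, transpose_vecMulVec]

omit [DecidableEq d] in
/-- `c·uuᵀ ⪰ 0` for `c ≥ 0`. [folklore] -/
private theorem smul_vecMulVec_posSemidef {c : ℝ} (hc : 0 ≤ c) (u : d → ℝ) :
    (c • vecMulVec u u).PosSemidef := by
  have hpsd : (vecMulVec u u).PosSemidef := by
    simpa using posSemidef_vecMulVec_self_star u
  exact hpsd.smul hc

/-- `I − c·uuᵀ ⪰ 0` whenever `c·(u·u) ≤ 1`. [folklore] -/
private theorem one_sub_smul_vecMulVec_posSemidef {c : ℝ} (u : d → ℝ) (hcu : c * (u ⬝ᵥ u) ≤ 1) :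
    (1 - c • vecMulVec u u).PosSemidef := by
  by_cases hu : u ⬝ᵥ u = 0
  · have hu0 : u = 0 := dotProduct_self_eq_zero.1 hu
    simp only [hu0, vecMulVec_zero, smul_zero, sub_zero]
    exact PosSemidef.one
  · -- `1 − c·uuᵀ = (1 − P) + (1 − c(u·u))·P` with `P` the projection onto `u`
    have hP1 := posSemidef_one_sub_of_transpose_of_idem (rankOneProj_transpose _ u) (rankOneProj_idem hu)
    have hP := posSemidef_of_transpose_of_idem (rankOneProj_transpose _ u) (rankOneProj_idem hu)
    have hdecomp : 1 - c • vecMulVec u u =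
        (1 - (u ⬝ᵥ u)⁻¹ • vecMulVec u u) + (1 - c * (u ⬝ᵥ u)) • ((u ⬝ᵥ u)⁻¹ • vecMulVec u u) := by
      rw [sub_smul, one_smul, smul_smul, mul_assoc, mul_inv_cancel₀ hu, mul_one]
      abel
    rw [hdecomp]
    exact hP1.add (hP.smul (by linarith))

end RankOne

/-! ### §3 The unique-disjointness instance -/

variable {n : ℕ}

/-- The weight: uniform probability on the `3^n` DISJOINT pairs `(a, b)`, `a, b ⊆ [n]`.
[cite: FioriniEtAl2015, §2 (the matrix M, its support) and §5.3, Thm. 21] -/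
def udisjWeight (n : ℕ) (a b : Finset (Fin n)) : ℝ := if Disjoint a b then 1 / (3 : ℝ) ^ n else 0

/-- The tight pattern of UDISJ: `|a ∩ b| = 1` (the zeros of `(1 − aᵀb)²`). [cite: FioriniEtAl2015, §2 (M_{ab} = (1 − aᵀb)²)] -/
def udisjTight (a b : Finset (Fin n)) : Prop := (a ∩ b).card = 1

/-- Alice's vector `(1, −1_a) ∈ ℝ^{n+1}`. [cite: FioriniEtAl2015, §5.3, Cor. 22 (T_a = (1,−a)(1,−a)ᵀ)] -/
def udisjRowVec (a : Finset (Fin n)) : Fin (n + 1) → ℝ :=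
  vecCons 1 fun i => if i ∈ a then -1 else 0

/-- Bob's vector `(1, 1_b) ∈ ℝ^{n+1}`. [cite: FioriniEtAl2015, §5.3, Cor. 22 (U^b = (1,b)(1,b)ᵀ)] -/
def udisjColVec (b : Finset (Fin n)) : Fin (n + 1) → ℝ :=
  vecCons 1 fun i => if i ∈ b then 1 else 0

/-- `⟨(1,−1_a), (1,1_b)⟩ = 1 − |a ∩ b|`. [cite: FioriniEtAl2015, §5.3, Cor. 22 (Tr[T_a U^b] = (1 − aᵀb)²)] -/
theorem udisjRowVec_dotProduct_udisjColVec (a b : Finset (Fin n)) :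
    udisjRowVec a ⬝ᵥ udisjColVec b = 1 - ((a ∩ b).card : ℝ) := by
  rw [udisjRowVec, udisjColVec, cons_dotProduct_cons, one_mul, dotProduct]
  have h : ∀ i : Fin n, (if i ∈ a then (-1 : ℝ) else 0) * (if i ∈ b then (1 : ℝ) else 0) =
      if i ∈ a ∩ b then (-1 : ℝ) else 0 := by
    intro i
    by_cases ha : i ∈ a <;> by_cases hb : i ∈ b <;> simp [ha, hb]
  simp_rw [h]
  rw [Finset.sum_ite_mem, univ_inter, sum_const, nsmul_eq_mul]
  ring

/-- `‖(1,−1_a)‖² = 1 + |a| ≤ n + 1`. [cite: FioriniEtAl2015, §5.3, Cor. 22] -/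
theorem udisjRowVec_normSq (a : Finset (Fin n)) : udisjRowVec a ⬝ᵥ udisjRowVec a = 1 + (a.card : ℝ) := by
  rw [udisjRowVec, cons_dotProduct_cons, one_mul, dotProduct]
  have h : ∀ i : Fin n, (if i ∈ a then (-1 : ℝ) else 0) * (if i ∈ a then (-1 : ℝ) else 0) =
      if i ∈ a then (1 : ℝ) else 0 := by
    intro i
    by_cases ha : i ∈ a <;> simp [ha]
  simp_rw [h]
  rw [Finset.sum_ite_mem, univ_inter, sum_const, nsmul_eq_mul, mul_one]

/-- `‖(1,1_b)‖² = 1 + |b|`. [cite: FioriniEtAl2015, §5.3, Cor. 22] -/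
theorem udisjColVec_normSq (b : Finset (Fin n)) : udisjColVec b ⬝ᵥ udisjColVec b = 1 + (b.card : ℝ) := by
  rw [udisjColVec, cons_dotProduct_cons, one_mul, dotProduct]
  have h : ∀ i : Fin n, (if i ∈ b then (1 : ℝ) else 0) * (if i ∈ b then (1 : ℝ) else 0) =
      if i ∈ b then (1 : ℝ) else 0 := by
    intro i
    by_cases hb : i ∈ b <;> simp [hb]
  simp_rw [h]
  rw [Finset.sum_ite_mem, univ_inter, sum_const, nsmul_eq_mul, mul_one]

/-- A subset of `[n]` has at most `n` elements, so `1 + |a| ≤ n + 1`. [folklore] -/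
private theorem one_add_card_le (a : Finset (Fin n)) : 1 + (a.card : ℝ) ≤ (n : ℝ) + 1 := by
  have : a.card ≤ n := le_trans (card_le_univ a) (by rw [Fintype.card_fin])
  have h' : (a.card : ℝ) ≤ n := by exact_mod_cast this
  linarith

/-- Alice's pure state, normalised to a contraction: `X_a = (1,−1_a)(1,−1_a)ᵀ/(n+1)`.
[cite: FioriniEtAl2015, §5.3, Cor. 22 (T_a)] -/
def udisjX (n : ℕ) (a : Finset (Fin n)) : Matrix (Fin (n + 1)) (Fin (n + 1)) ℝ :=
  (1 / ((n : ℝ) + 1)) • vecMulVec (udisjRowVec a) (udisjRowVec a)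

/-- Bob's pure state, normalised to a contraction: `Y_b = (1,1_b)(1,1_b)ᵀ/(n+1)`.
[cite: FioriniEtAl2015, §5.3, Cor. 22 (U^b)] -/
def udisjY (n : ℕ) (b : Finset (Fin n)) : Matrix (Fin (n + 1)) (Fin (n + 1)) ℝ :=
  (1 / ((n : ℝ) + 1)) • vecMulVec (udisjColVec b) (udisjColVec b)

/-- `tr(X_a Y_b) = (1 − |a ∩ b|)²/(n+1)²`. [cite: FioriniEtAl2015, §5.3, Cor. 22 (Tr[T_a U^b] = (1 − aᵀb)² = M_{ab})] -/
theorem trace_udisjX_mul_udisjY (a b : Finset (Fin n)) :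
    (udisjX n a * udisjY n b).trace = (1 - ((a ∩ b).card : ℝ)) ^ 2 / ((n : ℝ) + 1) ^ 2 := by
  rw [udisjX, udisjY, trace_smul_vecMulVec_mul_smul_vecMulVec, udisjRowVec_dotProduct_udisjColVec]
  have hn : (n : ℝ) + 1 ≠ 0 := by positivity
  field_simp

/-- Tightness: `X_a Y_b = 0` whenever `|a ∩ b| = 1` (the two pure states are orthogonal).
[cite: FioriniEtAl2015, §5.3, Cor. 22] -/
theorem udisjX_mul_udisjY_eq_zero {a b : Finset (Fin n)} (h : (a ∩ b).card = 1) :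
    udisjX n a * udisjY n b = 0 := by
  rw [udisjX, udisjY, smul_vecMulVec_mul_smul_vecMulVec, udisjRowVec_dotProduct_udisjColVec, h]
  simp

/-- **The UDISJ strategy is a tight psd rectangle of dimension `n + 1`.** [cite: FioriniEtAl2015, §5.3, Thm. 21 and Cor. 22] -/
theorem isTightPsdRect_udisj (n : ℕ) : IsTightPsdRect (udisjTight (n := n)) (udisjX n) (udisjY n) := by
  have hc : (0 : ℝ) ≤ 1 / ((n : ℝ) + 1) := by positivity
  have hn : (0 : ℝ) < (n : ℝ) + 1 := by positivity
  refine ⟨fun a => ⟨smul_vecMulVec_posSemidef hc _, one_sub_smul_vecMulVec_posSemidef _ ?_⟩,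
    fun b => ⟨smul_vecMulVec_posSemidef hc _, one_sub_smul_vecMulVec_posSemidef _ ?_⟩,
    fun a b hab => udisjX_mul_udisjY_eq_zero hab⟩
  · rw [udisjRowVec_normSq, div_mul_eq_mul_div, one_mul, div_le_one hn]
    exact one_add_card_le a
  · rw [udisjColVec_normSq, div_mul_eq_mul_div, one_mul, div_le_one hn]
    exact one_add_card_le b

/-- The disjoint pairs of subsets of `[n]`, as a filter of all pairs, are Kaibel–Weltge's `disjpairs([n])`;
there are `3^n` of them. [cite: KaibelWeltge2014, §2 (|disjpairs(n)| = 3^n)] -/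
theorem card_filter_disjoint (n : ℕ) :
    ((univ : Finset (Finset (Fin n) × Finset (Fin n))).filter (fun p => Disjoint p.1 p.2)).card = 3 ^ n := by
  have h : (univ : Finset (Finset (Fin n) × Finset (Fin n))).filter (fun p => Disjoint p.1 p.2) =
      disjPairs (univ : Finset (Fin n)) := by
    ext p
    simp [mem_disjPairs]
  rw [h, card_disjPairs, card_univ, Fintype.card_fin]

/-- **The value of the UDISJ strategy is `1/(n+1)³`**: against the uniform weight on disjoint pairs every term is
`tr(X_a Y_b) = 1/(n+1)²`, and the normalisation divides by `r = n + 1`. [cite: FioriniEtAl2015, §5.3, Thm. 21] -/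
theorem tracialValue_udisj (n : ℕ) :
    tracialValue (udisjWeight n) (udisjX n) (udisjY n) = 1 / ((n : ℝ) + 1) ^ 3 := by
  classical
  rw [tracialValue]
  have hterm : ∀ a b : Finset (Fin n), udisjWeight n a b * (udisjX n a * udisjY n b).trace =
      if Disjoint a b then (1 / (3 : ℝ) ^ n) * (1 / ((n : ℝ) + 1) ^ 2) else 0 := by
    intro a b
    rw [udisjWeight]
    split_ifs with h
    · rw [trace_udisjX_mul_udisjY, disjoint_iff_inter_eq_empty.1 h, card_empty, Nat.cast_zero, sub_zero,
        one_pow]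
    · rw [zero_mul]
  simp_rw [hterm]
  rw [← Finset.sum_product' (f := fun a b =>
      if Disjoint a b then (1 / (3 : ℝ) ^ n) * (1 / ((n : ℝ) + 1) ^ 2) else 0), univ_product_univ,
    ← sum_filter, sum_const, card_filter_disjoint, nsmul_eq_mul, Nat.cast_pow, Nat.cast_ofNat,
    Nat.cast_succ]
  have h3 : (3 : ℝ) ^ n ≠ 0 := by positivity
  have hn : (n : ℝ) + 1 ≠ 0 := by positivity
  field_simp

/-- **One-sided rectangle decay for UDISJ (Kaibel–Weltge's count):** a 0/1 rectangle `A × B` on which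
`|a ∩ b| ≠ 1` throughout contains at most `2^n` disjoint pairs, i.e. has `W`-mass `≤ (2/3)^n`.
[cite: KaibelWeltge2014, Thm. 1] [cite: FioriniEtAl2015, §2, Thm. 1] -/
theorem udisj_rectMass_le (A B : Finset (Finset (Fin n))) (hfree : ∀ a ∈ A, ∀ b ∈ B, ¬udisjTight a b) :
    rectMass (udisjWeight n) A B ≤ (2 / 3 : ℝ) ^ n := by
  classical
  -- the disjoint pairs of the rectangle form a Kaibel–Weltge valid set
  set R : Finset (Finset (Fin n) × Finset (Fin n)) :=
    (disjPairs (univ : Finset (Fin n))).filter (fun p => p.1 ∈ A ∧ p.2 ∈ B) with hR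
  have hval : IsKWValid R := by
    intro p hp q hq
    have hp' := (mem_filter.1 hp).2
    have hq' := (mem_filter.1 hq).2
    exact hfree p.1 hp'.1 q.2 hq'.2
  have hcard : R.card ≤ 2 ^ n := by
    have h := IsKWValid.card_le_two_pow (univ : Finset (Fin n)) R hval (filter_subset _ _)
    rwa [card_univ, Fintype.card_fin] at h
  -- the mass is `|R| / 3^n`
  have hmass : rectMass (udisjWeight n) A B = (R.card : ℝ) / (3 : ℝ) ^ n := by
    rw [rectMass]
    have h1 : ∑ a ∈ A, ∑ b ∈ B, udisjWeight n a b =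
        ∑ p ∈ A ×ˢ B, (if Disjoint p.1 p.2 then 1 / (3 : ℝ) ^ n else 0) :=
      (Finset.sum_product A B (fun p => if Disjoint p.1 p.2 then 1 / (3 : ℝ) ^ n else 0)).symm
    rw [h1, ← sum_filter, sum_const, nsmul_eq_mul]
    have h2 : (A ×ˢ B).filter (fun p => Disjoint p.1 p.2) = R := by
      ext p
      simp only [hR, mem_filter, mem_product, mem_disjPairs, subset_univ, true_and]
      tauto
    rw [h2]
    ring
  rw [hmass, div_pow, div_le_div_iff_of_pos_right (by positivity)]
  exact_mod_cast hcard

/-- The weight is nonnegative. [cite: FioriniEtAl2015, §2] -/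
theorem udisjWeight_nonneg (a b : Finset (Fin n)) : 0 ≤ udisjWeight n a b := by
  unfold udisjWeight
  split_ifs <;> positivity

/-! ### §4 The barrier -/

/-- **BARRIER: every generic one-sided transfer principle loses at least `(3/2)^n/(n+1)³` in dimension `n + 1`.**
(Apply the principle to UDISJ: `T`-free rectangles have mass `≤ (2/3)^n`, the tight pure-state strategy of
dimension `n+1` has value `1/(n+1)³`.) [cite: FioriniEtAl2015, §5.3, Thm. 21 and Cor. 22] [cite: KaibelWeltge2014, Thm. 1] -/
theorem genericOneSidedTransfer_loss {F : ℕ → ℝ} (hF : GenericOneSidedTransfer F) (n : ℕ) :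
    1 / ((n : ℝ) + 1) ^ 3 ≤ F (n + 1) * (2 / 3 : ℝ) ^ n := by
  have h := hF (Finset (Fin n)) (Finset (Fin n)) udisjTight (udisjWeight n) ((2 / 3 : ℝ) ^ n) (n + 1)
    udisjWeight_nonneg udisj_rectMass_le (udisjX n) (udisjY n) (isTightPsdRect_udisj n)
  rwa [tracialValue_udisj] at h

/-- The same in the form «loss ≥ (3/2)^n/(n+1)³» — exponential in the dimension `r = n + 1`.
[cite: FioriniEtAl2015, §5.3, Cor. 22] -/
theorem genericOneSidedTransfer_loss' {F : ℕ → ℝ} (hF : GenericOneSidedTransfer F) (n : ℕ) :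
    (3 / 2 : ℝ) ^ n / ((n : ℝ) + 1) ^ 3 ≤ F (n + 1) := by
  have h := genericOneSidedTransfer_loss hF n
  have h23 : (0 : ℝ) < (2 / 3 : ℝ) ^ n := by positivity
  have hn : (0 : ℝ) < ((n : ℝ) + 1) ^ 3 := by positivity
  rw [div_le_iff₀ hn]
  have h' : 1 ≤ F (n + 1) * (2 / 3 : ℝ) ^ n * ((n : ℝ) + 1) ^ 3 := by
    have := mul_le_mul_of_nonneg_right h hn.le
    rwa [one_div, inv_mul_cancel₀ hn.ne'] at this
  have hprod : (3 / 2 : ℝ) ^ n * (2 / 3 : ℝ) ^ n = 1 := by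
    rw [← mul_pow]; norm_num
  calc (3 / 2 : ℝ) ^ n = (3 / 2 : ℝ) ^ n * 1 := by ring
    _ ≤ (3 / 2 : ℝ) ^ n * (F (n + 1) * (2 / 3 : ℝ) ^ n * ((n : ℝ) + 1) ^ 3) :=
        mul_le_mul_of_nonneg_left h' (by positivity)
    _ = F (n + 1) * ((n : ℝ) + 1) ^ 3 * ((3 / 2 : ℝ) ^ n * (2 / 3 : ℝ) ^ n) := by ring
    _ = F (n + 1) * ((n : ℝ) + 1) ^ 3 := by rw [hprod, mul_one]

/-- **No polynomial loss.** For every `C` and `k`, the generic one-sided transfer principle with loss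
`F(r) = C·r^k` is FALSE (since `n^{k+3}·(2/3)^n → 0`). In particular the `r = 1` rung of the cell's crux cannot be
lifted to dimension `r` by a structure-blind argument with the polynomial loss the crux could absorb.
[cite: FioriniEtAl2015, §5.3, Thm. 21 and Cor. 22] [cite: KaibelWeltge2014, Thm. 1] -/
theorem not_genericOneSidedTransfer_poly (C : ℝ) (k : ℕ) :
    ¬GenericOneSidedTransfer (fun r => C * (r : ℝ) ^ k) := by
  intro hF
  -- `m^{k+3} / (3/2)^m → 0`, so eventually `C · 2^{k+3} · m^{k+3} (2/3)^m < 1`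
  have hlim := tendsto_pow_const_div_const_pow_of_one_lt (k + 3) (by norm_num : (1 : ℝ) < 3 / 2)
  have hC : (0 : ℝ) < |C| * 2 ^ (k + 3) + 1 := by positivity
  have hev := (hlim.eventually (gt_mem_nhds (show (0 : ℝ) < 1 / (|C| * 2 ^ (k + 3) + 1) by positivity))).and
    (eventually_ge_atTop 1)
  obtain ⟨m, hm, hm1⟩ := hev.exists
  -- the barrier at `n = m`
  have hloss := genericOneSidedTransfer_loss hF m
  have hm1R : (1 : ℝ) ≤ m := by exact_mod_cast hm1
  have hmpos : (0 : ℝ) < (m : ℝ) + 1 := by positivity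
  -- `(m+1)^{k} (m+1)^3 ≤ 2^{k+3} m^{k+3}`
  have hpow : ((m : ℝ) + 1) ^ k * ((m : ℝ) + 1) ^ 3 ≤ 2 ^ (k + 3) * (m : ℝ) ^ (k + 3) := by
    rw [← pow_add, ← mul_pow]
    exact pow_le_pow_left₀ (by positivity) (by linarith) (k + 3)
  -- `(2/3)^m = 1/(3/2)^m`
  have h23 : (2 / 3 : ℝ) ^ m = 1 / (3 / 2 : ℝ) ^ m := by
    rw [one_div, ← inv_pow]; norm_num
  have h32pos : (0 : ℝ) < (3 / 2 : ℝ) ^ m := by positivity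
  -- from the barrier: `1 ≤ C (m+1)^k (2/3)^m (m+1)^3`
  have h1 : 1 ≤ C * ((m : ℝ) + 1) ^ k * (2 / 3 : ℝ) ^ m * ((m : ℝ) + 1) ^ 3 := by
    have hn : (0 : ℝ) < ((m : ℝ) + 1) ^ 3 := by positivity
    have := mul_le_mul_of_nonneg_right hloss hn.le
    rw [one_div, inv_mul_cancel₀ hn.ne'] at this
    push_cast at this
    linarith
  -- bound the right-hand side by `|C| 2^{k+3} · (m^{k+3}/(3/2)^m) < 1`
  have h2 : C * ((m : ℝ) + 1) ^ k * (2 / 3 : ℝ) ^ m * ((m : ℝ) + 1) ^ 3 ≤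
      |C| * 2 ^ (k + 3) * ((m : ℝ) ^ (k + 3) / (3 / 2 : ℝ) ^ m) := by
    have hle : C * ((m : ℝ) + 1) ^ k * (2 / 3 : ℝ) ^ m * ((m : ℝ) + 1) ^ 3 ≤
        |C| * (((m : ℝ) + 1) ^ k * ((m : ℝ) + 1) ^ 3) * (2 / 3 : ℝ) ^ m := by
      have hx : 0 ≤ (((m : ℝ) + 1) ^ k * ((m : ℝ) + 1) ^ 3) * (2 / 3 : ℝ) ^ m := by positivity
      calc C * ((m : ℝ) + 1) ^ k * (2 / 3 : ℝ) ^ m * ((m : ℝ) + 1) ^ 3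
          = C * ((((m : ℝ) + 1) ^ k * ((m : ℝ) + 1) ^ 3) * (2 / 3 : ℝ) ^ m) := by ring
        _ ≤ |C| * ((((m : ℝ) + 1) ^ k * ((m : ℝ) + 1) ^ 3) * (2 / 3 : ℝ) ^ m) :=
            mul_le_mul_of_nonneg_right (le_abs_self C) hx
        _ = |C| * (((m : ℝ) + 1) ^ k * ((m : ℝ) + 1) ^ 3) * (2 / 3 : ℝ) ^ m := by ring
    refine le_trans hle ?_
    rw [h23]
    have : |C| * (((m : ℝ) + 1) ^ k * ((m : ℝ) + 1) ^ 3) * (1 / (3 / 2 : ℝ) ^ m) =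
        |C| * (((m : ℝ) + 1) ^ k * ((m : ℝ) + 1) ^ 3) / (3 / 2 : ℝ) ^ m := by ring
    rw [this, mul_div_assoc, mul_assoc]
    refine mul_le_mul_of_nonneg_left ?_ (abs_nonneg C)
    rw [← mul_div_assoc]
    exact div_le_div_of_nonneg_right hpow h32pos.le
  have h3 : |C| * 2 ^ (k + 3) * ((m : ℝ) ^ (k + 3) / (3 / 2 : ℝ) ^ m) < 1 := by
    have hq : (m : ℝ) ^ (k + 3) / (3 / 2 : ℝ) ^ m < 1 / (|C| * 2 ^ (k + 3) + 1) := hm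
    have hq0 : 0 ≤ (m : ℝ) ^ (k + 3) / (3 / 2 : ℝ) ^ m := by positivity
    calc |C| * 2 ^ (k + 3) * ((m : ℝ) ^ (k + 3) / (3 / 2 : ℝ) ^ m)
        ≤ (|C| * 2 ^ (k + 3) + 1) * ((m : ℝ) ^ (k + 3) / (3 / 2 : ℝ) ^ m) :=
          mul_le_mul_of_nonneg_right (by linarith) hq0
      _ < (|C| * 2 ^ (k + 3) + 1) * (1 / (|C| * 2 ^ (k + 3) + 1)) := mul_lt_mul_of_pos_left hq hC
      _ = 1 := by field_simp
  linarith

/-- The sign-unrestricted principle with polynomial loss is false as well. [cite: FioriniEtAl2015, §5.3, Thm. 21 and Cor. 22] -/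
theorem not_genericOneSidedTransferSigned_poly (C : ℝ) (k : ℕ) :
    ¬GenericOneSidedTransferSigned (fun r => C * (r : ℝ) ^ k) :=
  fun h => not_genericOneSidedTransfer_poly C k h.restrict

end Literature.Barriers.PneNP

end
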